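import Literature.MathematicalPhysics.QuantumFieldTheory.Balaban1983to89.B9Thm311PosViaLocalInversesY

/-!
# `Balaban1983to89.B9Thm311PosViaLocalFamilyY` — [B9] THEOREM 3.11 FOR `Δ_a` (p. 416) WITH AN ARBITRARY FAMILY OF LOCAL OPERATORS `T_□`: the
# localisation identity of (3.105) in its printed shape `Δ_a·G₀ = 1 − R` for `G₀ = Σ_□ h_□G_□h_□`, `G_□` the inverse of a local operator `T_□` that may
# DIFFER from `Δ_a` (print's `Δ_{a,□}` with the local projection `R_□`), positivity of `G₀` from positivity of the `T_□`, and the row-17 face of the N06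
# certificate for any such family — the bridge named by the referee's WATCH-ROW17-LOCALISATION-MISMATCH as a TYPED hypothesis shape

statement-level skeleton of published theorems with citation tags; proofs where landed; nothing here is a claim about the
Yang–Mills mass gap

T. Bałaban, *Propagators for lattice gauge theories in a background field*, Commun. Math. Phys. **99** (1985) 389–434
[`Balaban1985BackgroundPropagators`, "[B9]"].  PDF held (`paper:balaban1985-cmp99-background-propagators`, journal page = PDF page + 388); pp. 414–416
re-read by this seat (2026-08-28).

THE PRINT (verbatim).  p. 414, (3.105)–(3.106): *«Δ_aG₀ = I − R, G = G₀(I − R)⁻¹»* with `G₀ = Σ_□ h_□G_□h_□` (3.87) over the LOCAL operators «constructed for the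
sequence {Ω_n(□)}» (p. 409); p. 416: *«By (3.106) G = G₀(I − R)⁻¹, R is an operator with small norm. … Thus we have to prove the positivity of G₀. By the
definition (3.87) it is enough to prove a positivity of the operators G_□ … by (3.86) we get G_□(e^{iηA}) = G_□(1)(I − V(A)G_□(1))⁻¹. In [4] we have proved
that the operator G_□(1) is positive, hence by the same reasoning as above we prove positivity of G_□.»*

WHY THIS FILE (cell context, pub-ymgap N06 DAG).  `B9Thm311PosViaLocalInversesY` (this lineage, p606819) typed the p. 416 road for row 17 (`hΔA`) with the local
operators taken to be the Dirichlet COMPRESSIONS `M_χ Δ_a(U) M_χ + 1 − M_χ` of the full `Δ_a(U)`.  The discharge referee (ref-A g28, READ-2) recorded that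
print's local operators are different objects — `Δ_{a,□}(U)` carries the LOCAL gauge projection `R_□` built from the local `G′_□`, `C_□`, whereas a compression
of `Δ_a(U)` still carries the global `R(U)` — and registered WATCH-ROW17-LOCALISATION-MISMATCH: a discharge on that road needs an un-printed bridge unless the
road is re-typed with print's operators.  This file re-types it ONCE FOR EVERY CHOICE: the local operators are an ARBITRARY family `T_c` (one per cube) whose
compressions are inverted; the identity `T·G₀ = 1 − R` then holds with print's (3.105)-shaped remainder `R = Σ_c (M_{h_c}T_c − T M_{h_c})·G_c·M_{h_c}` — the
commutator `[M_{h_c}, T]` plus the DEFECT `M_{h_c}(T_c − T)` — and `T` is positive definite as soon as every compressed `T_c` is and `R` is form-small.  With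
`T_c := Δ_a(U)` this is p606819's road; with `T_c :=` print's `Δ_{a,□}(U)` (once the local projection letter `R_□` is typed at def-Y's letters) it is print's.

WHAT IS PROVED (sorry-free; 0 `def`; fibres `M_N(ℂ)`, print's pairing `trIP w`, any `w > 0`, any finite carrier).
* §1 ★★ `mul_localFamilySum_eq_one_sub` (via p606819's `cutMulY_mul_T_mul_dirInvY_mul_cutMulY`: `h T_c G_c h = h²` for the local inverse `G_c = dirInvY (M_χ) T_c`)
  (`T·Σ_c M_{h_c}G_cM_{h_c} = 1 − Σ_c (M_{h_c}T_c − T M_{h_c})·G_c·M_{h_c}`), ★ `posDefTr_localFamilySum_of_local` (`G₀` is `PosDefTr` when every compressed `T_c` is).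
* §2 ★★ `posDefTr_of_localFamily_posDefTr_of_small`: `IsSymmTr w T` + (∀ c, `PosDefTr w (dirPadY (M_{χ_c}) (T_c))`) + (`⟨A, RA⟩_w ≤ θ⟨A, A⟩_w`, `θ < 1`) ⇒ `PosDefTr w T`.
* §3 ★★★ `deltaAY_parSymY_posDefTr_of_localFamily`: at def-Y's letters, `G ≤ U(N)`, `U` `G`-valued, ANY family `Tloc : ι → End_ℂ (FBondY → M_N(ℂ))`: the certificate's
  `PosDefTr 1 (deltaAY i (parSymY i) (parBY i) (GpY i (parSymY i)) U)` from (i) positivity of each compressed `Tloc c` and (ii) form-smallness of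
  `Σ_c (M_{h_c}·Tloc c − Δ_a(U)·M_{h_c})·G_c·M_{h_c}`; and `isUnit_∕GAY_` corollaries.

HONEST SCOPE.  Linear algebra and bookkeeping; the two inputs remain HYPOTHESES and are the analytic content (for print's `T_c = Δ_{a,□}`: Cor. 3.6 at the local
operators and the smallness of (3.105)'s `R`, whose defect part `D(R_□ − R)D*`-type terms print controls by Theorems 3.1–3.2); the local operators themselves
are a PARAMETER here (print's `Δ_{a,□}` is not constructed in this file).  Count-neutral (no new named fact; N06 NOT discharged; `hΔA` stays displayed); nothing
continuum, nothing about OS axioms or the mass gap.  No `sorry`, no `axiom`, no `instance`, no `notation`.  Seat `pub-ymgap-dag-n06-j` (bundle F5, rows 15–17),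
gen 20, 2026-08-28; NEW file; imports p606819 only; modifies nothing.
-/

noncomputable section

namespace Literature.MathematicalPhysics.QuantumFieldTheory.Balaban1983to89.B9Thm311PosViaLocalFamilyY

open B9Thm311ReadingCoords B9Thm311DeltaPrimePos B9Thm311LocalInversePosY B9Thm311PosViaLocalInversesY Node00 Node00.OpsYLocalInverse
open B9Thm37CubeCoverCommutators (cutMulY cutMulY_apply cutMulY_mul cutMulY_one)
open B6KLevelCensusIndexV1 (KIdx)
open scoped Matrix Matrix.Norms.L2Operator

/-! ## §1 The (3.105)-shaped identity for an arbitrary family of local operators, and the positivity of `G₀` -/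

section Family

variable {X : Type} {N : ℕ}

/-- ★★ **(3.105) FOR AN ARBITRARY FAMILY OF LOCAL OPERATORS**: with `G_c := dirInvY (M_{χ_c}) T_c` and `G₀ := Σ_c M_{h_c}G_cM_{h_c}`,
`T·G₀ = 1 − Σ_c (M_{h_c}T_c − T M_{h_c})·G_c·M_{h_c}` — the remainder is the COMMUTATOR `[M_{h_c}, T]` plus the DEFECT `M_{h_c}(T_c − T)`, read against `G_cM_{h_c}`.
[cite: Balaban1985BackgroundPropagators, (3.105) p.414, (3.88) p.409] -/
theorem mul_localFamilySum_eq_one_sub {ι : Type} [Fintype ι] (T : Module.End ℂ (X → Matrix (Fin N) (Fin N) ℂ))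
    (Tloc : ι → Module.End ℂ (X → Matrix (Fin N) (Fin N) ℂ))
    (hf : ι → X → ℝ) (hsq : ∀ z, ∑ c, hf c z ^ 2 = 1) (χ : ι → X → ℝ) (hχ : ∀ c z, χ c z = 0 ∨ χ c z = 1)
    (hsupp : ∀ c z, hf c z ≠ 0 → χ c z = 1) (hU : ∀ c, IsUnit (dirPadY (cutMulY (χ c)) (Tloc c))) :
    T * (∑ c, cutMulY (hf c) * dirInvY (cutMulY (χ c)) (Tloc c) * cutMulY (hf c))
      = 1 - ∑ c, (cutMulY (hf c) * Tloc c - T * cutMulY (hf c)) * dirInvY (cutMulY (χ c)) (Tloc c) * cutMulY (hf c) := by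
  rw [Finset.mul_sum, eq_sub_iff_add_eq, ← Finset.sum_add_distrib, ← sum_cutMulY_sq (N := N) hf hsq]
  refine Finset.sum_congr rfl fun c _ => ?_
  rw [← cutMulY_mul_T_mul_dirInvY_mul_cutMulY (hχ c) (hU c) (hf c) (hsupp c), sub_mul, sub_mul,
    ← mul_assoc T (cutMulY (hf c) * dirInvY (cutMulY (χ c)) (Tloc c)) (cutMulY (hf c)),
    ← mul_assoc T (cutMulY (hf c)) (dirInvY (cutMulY (χ c)) (Tloc c))]
  abel

variable [Fintype X]

/-- ★ **`G₀` IS POSITIVE DEFINITE AS SOON AS EVERY COMPRESSED LOCAL OPERATOR IS** (any family `T_c`, any weight `w`, `Σ_c h_c² = 1`, `supp h_c ⊆ {χ_c = 1}`).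
[cite: Balaban1985BackgroundPropagators, Thm 3.11 proof p.416 («it is enough to prove a positivity of the operators G_□»), (3.87) p.409] -/
theorem posDefTr_localFamilySum_of_local {w : X → ℝ} {ι : Type} [Fintype ι] (Tloc : ι → Module.End ℂ (X → Matrix (Fin N) (Fin N) ℂ))
    (hf : ι → X → ℝ) (hsq : ∀ z, ∑ c, hf c z ^ 2 = 1) (χ : ι → X → ℝ)
    (hsupp : ∀ c z, hf c z ≠ 0 → χ c z = 1) (hloc : ∀ c, PosDefTr w (dirPadY (cutMulY (χ c)) (Tloc c))) :
    PosDefTr w (∑ c, cutMulY (hf c) * dirInvY (cutMulY (χ c)) (Tloc c) * cutMulY (hf c)) := by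
  intro Ψ hΨ
  have hsum : trIP w Ψ ((∑ c, cutMulY (hf c) * dirInvY (cutMulY (χ c)) (Tloc c) * cutMulY (hf c) :
        Module.End ℂ (X → Matrix (Fin N) (Fin N) ℂ)) Ψ)
      = ∑ c, trIP w (cutMulY (hf c) Ψ) (dirInvY (cutMulY (χ c)) (Tloc c) (cutMulY (hf c) Ψ)) := by
    rw [LinearMap.sum_apply, trIP_sum_right_gen]
    refine Finset.sum_congr rfl fun c _ => ?_
    rw [Module.End.mul_apply, Module.End.mul_apply, trIP_cutMulY_right_gen]
  rw [hsum]
  have hnn : ∀ c ∈ Finset.univ, 0 ≤ trIP w (cutMulY (hf c) Ψ) (dirInvY (cutMulY (χ c)) (Tloc c) (cutMulY (hf c) Ψ)) :=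
    fun c _ => trIP_localInv_self_nonneg (hloc c) _
  rcases (Finset.sum_nonneg hnn).lt_or_eq with hlt | heq
  · exact hlt
  · exfalso
    have hall := (Finset.sum_eq_zero_iff_of_nonneg hnn).mp heq.symm
    refine hΨ (eq_zero_of_cutMulY_eq_zero_gen hf hsq fun c => ?_)
    by_contra hc
    have hPc : cutMulY (χ c) (cutMulY (hf c) Ψ) ≠ 0 := by
      have hcomm := cutMulY_mul_cutMulY_of_support' (N := N) (hf c) (χ c) (hsupp c)
      rwa [← Module.End.mul_apply, hcomm]
    exact (trIP_localInv_self_pos (hloc c) hPc).ne' (hall c (Finset.mem_univ c))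

end Family

/-! ## §2 Theorem 3.11's road with an arbitrary local family -/

section Assembly

variable {X : Type} [Fintype X] {N : ℕ}

/-- ★★ **THE LOCALISATION ROAD FOR AN ARBITRARY LOCAL FAMILY**: a trIP-symmetric `T` is positive definite as soon as (i) every compression `M_{χ_c}T_cM_{χ_c} + 1 − M_{χ_c}`
of the chosen local operators `T_c` is positive definite and (ii) the (3.105)-shaped remainder `R = Σ_c (M_{h_c}T_c − T M_{h_c})·G_c·M_{h_c}` is form-small,
`⟨A, RA⟩_w ≤ θ⟨A, A⟩_w`, `θ < 1`. [cite: Balaban1985BackgroundPropagators, Thm 3.11 proof p.416, (3.105)–(3.106) p.414, (3.87) p.409] -/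
theorem posDefTr_of_localFamily_posDefTr_of_small {w : X → ℝ} (hw : ∀ s, 0 < w s) {ι : Type} [Fintype ι]
    {T : Module.End ℂ (X → Matrix (Fin N) (Fin N) ℂ)} (hT : IsSymmTr w T) (Tloc : ι → Module.End ℂ (X → Matrix (Fin N) (Fin N) ℂ))
    (hf : ι → X → ℝ) (hsq : ∀ z, ∑ c, hf c z ^ 2 = 1) (χ : ι → X → ℝ) (hχ : ∀ c z, χ c z = 0 ∨ χ c z = 1)
    (hsupp : ∀ c z, hf c z ≠ 0 → χ c z = 1) (hloc : ∀ c, PosDefTr w (dirPadY (cutMulY (χ c)) (Tloc c))) {θ : ℝ} (hθ : θ < 1)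
    (hsmall : ∀ A : X → Matrix (Fin N) (Fin N) ℂ,
      trIP w A ((∑ c, (cutMulY (hf c) * Tloc c - T * cutMulY (hf c)) * dirInvY (cutMulY (χ c)) (Tloc c) * cutMulY (hf c) :
        Module.End ℂ (X → Matrix (Fin N) (Fin N) ℂ)) A) ≤ θ * trIP w A A) :
    PosDefTr w T :=
  posDefTr_of_mul_eq_one_sub_of_le hw hT (posDefTr_localFamilySum_of_local Tloc hf hsq χ hsupp hloc)
    (mul_localFamilySum_eq_one_sub T Tloc hf hsq χ hχ hsupp fun c => isUnit_of_posDefTr (hloc c)) hθ hsmall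

end Assembly

/-! ## §3 The row-17 face for an arbitrary local family at def-Y's letters -/

section Row17

variable {d ℓ : ℕ} {hd : 1 ≤ d + 1} {hL : Odd (ℓ + 1) ∧ 1 < ℓ + 1} {b₀ b₁ : ℝ} {N : ℕ}
variable (i : KIdx d ℓ hd hL b₀ b₁) {G : Subgroup (Matrix (Fin N) (Fin N) ℂ)ˣ}

/-- ★★★ **ROW 17 BY PRINT's ROAD, LOCAL OPERATORS ARBITRARY**: for `G ≤ U(N)`, a `G`-valued `U` and ANY family `Tloc` of operators on the bond functions (print's
`Δ_{a,□}(U)` with the local projection `R_□`, once typed; or the compressions' own `Δ_a(U)`, recovering p606819), the certificate's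
`PosDefTr 1 (deltaAY i (parSymY i) (parBY i) (GpY i (parSymY i)) U)` follows from (i) positivity of every compressed `Tloc c` and (ii) the form-smallness
of `Σ_c (M_{h_c}·Tloc c − Δ_a(U)·M_{h_c})·G_c·M_{h_c}` — the (3.105) remainder with its defect terms.
[cite: Balaban1985BackgroundPropagators, Thm 3.11 p.416, (3.105)–(3.106) p.414, (3.87) p.409] -/
theorem deltaAY_parSymY_posDefTr_of_localFamily (hG : G ≤ B7Prop2Explicit.unitaryUnits (Matrix (Fin N) (Fin N) ℂ))
    {U : CfgY (Matrix (Fin N) (Fin N) ℂ) i} (hU : ∀ μ x, U μ x ∈ G) {ι : Type} [Fintype ι]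
    (Tloc : ι → Module.End ℂ (FBondY i → Matrix (Fin N) (Fin N) ℂ))
    (hf : ι → FBondY i → ℝ) (hsq : ∀ b, ∑ c, hf c b ^ 2 = 1) (χ : ι → FBondY i → ℝ) (hχ : ∀ c b, χ c b = 0 ∨ χ c b = 1)
    (hsupp : ∀ c b, hf c b ≠ 0 → χ c b = 1)
    (hloc : ∀ c, PosDefTr (fun _ => (1 : ℝ)) (dirPadY (cutMulY (χ c)) (Tloc c)))
    {θ : ℝ} (hθ : θ < 1)
    (hsmall : ∀ A : FBondY i → Matrix (Fin N) (Fin N) ℂ,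
      trIP (fun _ => (1 : ℝ)) A ((∑ c, (cutMulY (hf c) * Tloc c - deltaAY i (parSymY i) (parBY i) (GpY i (parSymY i)) U * cutMulY (hf c))
          * dirInvY (cutMulY (χ c)) (Tloc c) * cutMulY (hf c) :
        Module.End ℂ (FBondY i → Matrix (Fin N) (Fin N) ℂ)) A) ≤ θ * trIP (fun _ => (1 : ℝ)) A A) :
    PosDefTr (fun _ => (1 : ℝ)) (deltaAY i (parSymY i) (parBY i) (GpY i (parSymY i)) U) :=
  posDefTr_of_localFamily_posDefTr_of_small (fun _ => one_pos) (deltaAY_parSymY_isSymmTr i hG hU) Tloc hf hsq χ hχ hsupp hloc hθ hsmall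

/-- hence `Δ_a(U)` is a unit, on the same two inputs. [cite: Balaban1985BackgroundPropagators, (3.27) p.395, Thm 3.11 p.416] -/
theorem isUnit_deltaAY_parSymY_of_localFamily (hG : G ≤ B7Prop2Explicit.unitaryUnits (Matrix (Fin N) (Fin N) ℂ))
    {U : CfgY (Matrix (Fin N) (Fin N) ℂ) i} (hU : ∀ μ x, U μ x ∈ G) {ι : Type} [Fintype ι]
    (Tloc : ι → Module.End ℂ (FBondY i → Matrix (Fin N) (Fin N) ℂ))
    (hf : ι → FBondY i → ℝ) (hsq : ∀ b, ∑ c, hf c b ^ 2 = 1) (χ : ι → FBondY i → ℝ) (hχ : ∀ c b, χ c b = 0 ∨ χ c b = 1)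
    (hsupp : ∀ c b, hf c b ≠ 0 → χ c b = 1)
    (hloc : ∀ c, PosDefTr (fun _ => (1 : ℝ)) (dirPadY (cutMulY (χ c)) (Tloc c)))
    {θ : ℝ} (hθ : θ < 1)
    (hsmall : ∀ A : FBondY i → Matrix (Fin N) (Fin N) ℂ,
      trIP (fun _ => (1 : ℝ)) A ((∑ c, (cutMulY (hf c) * Tloc c - deltaAY i (parSymY i) (parBY i) (GpY i (parSymY i)) U * cutMulY (hf c))
          * dirInvY (cutMulY (χ c)) (Tloc c) * cutMulY (hf c) :
        Module.End ℂ (FBondY i → Matrix (Fin N) (Fin N) ℂ)) A) ≤ θ * trIP (fun _ => (1 : ℝ)) A A) :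
    IsUnit (deltaAY i (parSymY i) (parBY i) (GpY i (parSymY i)) U) :=
  isUnit_of_posDefTr (deltaAY_parSymY_posDefTr_of_localFamily i hG hU Tloc hf hsq χ hχ hsupp hloc hθ hsmall)

/-- and `G(U) = Δ_a(U)⁻¹` (def-Y's `GAY`) is positive definite on the same two inputs. [cite: Balaban1985BackgroundPropagators, Thm 3.11 p.416, (3.27) p.395] -/
theorem GAY_parSymY_posDefTr_of_localFamily (hG : G ≤ B7Prop2Explicit.unitaryUnits (Matrix (Fin N) (Fin N) ℂ))
    {U : CfgY (Matrix (Fin N) (Fin N) ℂ) i} (hU : ∀ μ x, U μ x ∈ G) {ι : Type} [Fintype ι]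
    (Tloc : ι → Module.End ℂ (FBondY i → Matrix (Fin N) (Fin N) ℂ))
    (hf : ι → FBondY i → ℝ) (hsq : ∀ b, ∑ c, hf c b ^ 2 = 1) (χ : ι → FBondY i → ℝ) (hχ : ∀ c b, χ c b = 0 ∨ χ c b = 1)
    (hsupp : ∀ c b, hf c b ≠ 0 → χ c b = 1)
    (hloc : ∀ c, PosDefTr (fun _ => (1 : ℝ)) (dirPadY (cutMulY (χ c)) (Tloc c)))
    {θ : ℝ} (hθ : θ < 1)
    (hsmall : ∀ A : FBondY i → Matrix (Fin N) (Fin N) ℂ,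
      trIP (fun _ => (1 : ℝ)) A ((∑ c, (cutMulY (hf c) * Tloc c - deltaAY i (parSymY i) (parBY i) (GpY i (parSymY i)) U * cutMulY (hf c))
          * dirInvY (cutMulY (χ c)) (Tloc c) * cutMulY (hf c) :
        Module.End ℂ (FBondY i → Matrix (Fin N) (Fin N) ℂ)) A) ≤ θ * trIP (fun _ => (1 : ℝ)) A A) :
    PosDefTr (fun _ => (1 : ℝ)) (GAY i (parSymY i) (parBY i) (GpY i (parSymY i)) U) :=
  posDefTr_ringInverse (deltaAY_parSymY_posDefTr_of_localFamily i hG hU Tloc hf hsq χ hχ hsupp hloc hθ hsmall)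

end Row17

end Literature.MathematicalPhysics.QuantumFieldTheory.Balaban1983to89.B9Thm311PosViaLocalFamilyY

end
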